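import Summits.BirchSwinnertonDyer.BirchSwinnertonDyer.Theorems.PrintX10bBeyondCarrierOfWaldspurgerLink
import HarnessLib

/-!
# Crux `BeyondCarrierDepthX10b` (stmt-BirchSwinnertonDyer-23055, `route-BirchSwinnertonDyer-PrintX10b`
# rev 19): MATCHED TWINS for an ARBITRARY Howard-containment package `R` give the crux — the PIN-agnostic
# one-line re-run recipe (plan g9 FINDING PIN-1 (R3), line «twins», lead seat bsd-line-x10b-p1)

HONEST FRAMING (cell `run/shared/lean/pub/bsd-print-x9/`, D-0131 print tier): THEOREMS ONLY, conditional
glue, nothing booked, nothing closed. Sibling of `PrintX10bBeyondCarrierOfWaldspurgerLink.lean`, which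
proves the crux (and its parent J₃, item 21340) BY NAME from the per-frame two-sided IMC∘BDP–Waldspurger
link `W₃♯` (route item B₃'s text with its containment hypothesis deleted) and three cite-only facts
(`h331` JSW 2017 Thm. 3.3.1, `hKo` Kolyvagin 1990 Thm. A, `hChaL` Cha 2005 Rmk. 25 lower half). Here:
* `waldspurgerLink_of_matchedTwins` — for an ARBITRARY package `R W p K κ γ Dt H ιC : Prop`, an A-twin
  producing `R` on the SHARP frame (every binder any typing of A₃ asks for is available there: `Odd d_K`,
  `d_K ∉ {-3,-4}`, `(E/K)[p]` irreducible, `¬ p ∣ Dt.c`, `P = y_K` Heegner, rank one, `Ш[p^∞]` finite,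
  `P` non-torsion) and a B-twin turning `R` into the link on the same frame give `W₃♯` — pure logic;
* `beyondCarrierDepthX10b_of_matchedTwins_of_namedFacts` — hence `BeyondCarrierDepthX10b` BY NAME.
Instances (each by weakening its A to the sharp frame): the rev-19 items A₃ = 23729 / B₃ = 23730
(`R := ∃ jbar D F X, I(ℋ_F)² ≤ char(X_tors)`, unpinned), x10b-p1-w2's sharp A₃♯ (p606574), and the pinned
items of the announced PrintX10b rev 20 (`R := ∃ jbar D F X, F.Dt = Dt ∧ …`, plan g9 PIN-1 (R1)/(R3)) —
zero new Lean at the re-run. The open content is untouched: W₃♯ / the pinned twins are beyond print at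
`p = 3` on the `3 ∣ h_K` frames (cell DOSSIER §41.12–41.13; PIN-1 §5: the μ-part for the pinned family).
«beyond-print theorem»: NO. BSD is not proved by any of this.

References: [Cha2005] Thm. 21, Rmk. 25; [JetchevSkinnerWan2017] Thm. 3.3.1; [Kolyvagin1990] Thm. A;
[Howard2004HeegnerKolyvagin] Thm. B (the shape of `R` in every typing so far); plan g9
`plan/findings/PIN-1-unpinned-heegner-family.md` (R0)–(R3); route file `Theses/PrintX10b.lean` rev 19.
-/

-- the REGISTERED stub namespace `Summit.BirchSwinnertonDyer.BirchSwinnertonDyer.Cruxes.…` repeats the summit name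
set_option linter.dupNamespace false
set_option autoImplicit false

noncomputable section

open scoped Classical

open WeierstrassCurve NumberField
  Literature.NumberTheory.EllipticCurves Literature.NumberTheory.EllipticCurves.ModularForms
  Literature.NumberTheory.EllipticCurves.JetchevSkinnerWan2017
  Summit.BirchSwinnertonDyer.Rank1Residual
  Summit.BirchSwinnertonDyer.BirchSwinnertonDyer.Theses.PrintX10b

namespace Summit.BirchSwinnertonDyer.BirchSwinnertonDyer.Cruxes.BeyondCarrierDepthX10b.HowardFrames

/-! ### Matched twins for an ARBITRARY containment package `R` -/

/-- **Matched twins give the per-frame Waldspurger link `W₃♯`, for ANY package `R`.** If an A-twin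
produces `R W p K κ γ Dt H ιC` on the sharp frame (every binder the route's A₃, x10b-p1-w2's A₃♯ or the
announced pinned A₃^pin may ask for is available: `Odd d_K`, `d_K ∉ {-3,-4}`, `(E/K)[p]` irreducible,
`¬ p ∣ Dt.c`, `P = y_K` Heegner, rank one, `Ш[p^∞]` finite, `P` non-torsion) and a B-twin turns `R` into
the link on the same frame, then `W₃♯` holds. Pure logic: the glue of crux 23055 never inspects the
Howard-containment package — so the plan g9 PIN-1 re-typing (`R := ∃ jbar D F X, F.Dt = Dt ∧
¬ p ∣ F.Dt.c ∧ I(ℋ_F)² ≤ char(X_tors)`, or any other) re-runs the line by instantiating `R`.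
[cite: Howard2004HeegnerKolyvagin, Thm. B (the shape of R in every typing so far)] -/
theorem waldspurgerLink_of_matchedTwins
    (R : ∀ (W : WeierstrassCurve ℚ) [NeZero (W.conductorNorm ℤ)] (p : ℕ) [Fact p.Prime]
      (K : Type) [Field K] [NumberField K],
      Literature.NumberTheory.EllipticCurves.ZpExtension K p → Field.absoluteGaloisGroup K →
      Literature.NumberTheory.EllipticCurves.ModularForms.ModularParametrizationData W (W.conductorNorm ℤ) →
      Literature.NumberTheory.EllipticCurves.HeegnerDatum (W.conductorNorm ℤ) (NumberField.discr K) →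
      (K →+* ℂ) → Prop)
    (hA : ∀ (W : WeierstrassCurve ℚ) [W.IsElliptic] [W.IsGloballyMinimal] (p : ℕ) [Fact p.Prime]
    [NeZero (W.conductorNorm ℤ)] (K : Type) [Field K] [NumberField K],
    Literature.NumberTheory.EllipticCurves.Rank1Residual.ClassX10 W p →
    ¬ Literature.NumberTheory.EllipticCurves.Rank1Residual.Surj W 3 → ¬ W.HasCM →
    Literature.NumberTheory.EllipticCurves.IsImaginaryQuadratic K → Odd (NumberField.discr K) →
    NumberField.discr K ≠ -3 → NumberField.discr K ≠ -4 →
    Literature.NumberTheory.EllipticCurves.SatisfiesHeegnerHypothesis (W.conductorNorm ℤ) K →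
    Literature.NumberTheory.EllipticCurves.SatisfiesHeegnerHypothesis p K →
    (W.baseChange K).HasIrreducibleModPGaloisRep p →
    ∀ (ι : K →+* ℚ_[p]) (κ : Literature.NumberTheory.EllipticCurves.ZpExtension K p), κ.IsAnticyclotomic →
    ∀ (γ : Field.absoluteGaloisGroup K) [Fact (κ.IsTopGenerator γ)]
      (Dt : Literature.NumberTheory.EllipticCurves.ModularForms.ModularParametrizationData W
        (W.conductorNorm ℤ)), ¬ (p : ℤ) ∣ Dt.c →
    ∀ (H : Literature.NumberTheory.EllipticCurves.HeegnerDatum (W.conductorNorm ℤ) (NumberField.discr K))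
      (ιC : K →+* ℂ) (P : (W.baseChange K).toAffine.Point),
      WeierstrassCurve.Affine.Point.map ιC.toRatAlgHom P =
        Literature.NumberTheory.EllipticCurves.ModularForms.heegnerPointComplex Dt H →
      (W.baseChange K).mordellWeilRank = 1 →
      Finite (AddCommGroup.primaryComponent (W.baseChange K).sha p) → ¬ IsOfFinAddOrder P →
      R W p K κ γ Dt H ιC)
    (hB : ∀ (W : WeierstrassCurve ℚ) [W.IsElliptic] [W.IsGloballyMinimal] (p : ℕ) [Fact p.Prime]
    [NeZero (W.conductorNorm ℤ)] (K : Type) [Field K] [NumberField K],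
    Literature.NumberTheory.EllipticCurves.Rank1Residual.ClassX10 W p →
    ¬ Literature.NumberTheory.EllipticCurves.Rank1Residual.Surj W 3 → ¬ W.HasCM →
    Literature.NumberTheory.EllipticCurves.IsImaginaryQuadratic K → Odd (NumberField.discr K) →
    NumberField.discr K ≠ -3 → NumberField.discr K ≠ -4 →
    Literature.NumberTheory.EllipticCurves.SatisfiesHeegnerHypothesis (W.conductorNorm ℤ) K →
    Literature.NumberTheory.EllipticCurves.SatisfiesHeegnerHypothesis p K →
    (W.baseChange K).HasIrreducibleModPGaloisRep p →
    ∀ (ι : K →+* ℚ_[p]) (κ : Literature.NumberTheory.EllipticCurves.ZpExtension K p), κ.IsAnticyclotomic →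
    ∀ (γ : Field.absoluteGaloisGroup K) [Fact (κ.IsTopGenerator γ)]
      (Dt : Literature.NumberTheory.EllipticCurves.ModularForms.ModularParametrizationData W
        (W.conductorNorm ℤ)), ¬ (p : ℤ) ∣ Dt.c →
    ∀ (H : Literature.NumberTheory.EllipticCurves.HeegnerDatum (W.conductorNorm ℤ) (NumberField.discr K))
      (ιC : K →+* ℂ) (P : (W.baseChange K).toAffine.Point),
      WeierstrassCurve.Affine.Point.map ιC.toRatAlgHom P =
        Literature.NumberTheory.EllipticCurves.ModularForms.heegnerPointComplex Dt H →
      (W.baseChange K).mordellWeilRank = 1 →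
      Finite (AddCommGroup.primaryComponent (W.baseChange K).sha p) → ¬ IsOfFinAddOrder P →
      R W p K κ γ Dt H ιC →
      Summit.BirchSwinnertonDyer.Rank1Residual.X11b.IMCWaldspurgerOnTreeGoodAt p κ
        (Summit.BirchSwinnertonDyer.Rank1Residual.X11b.inducedPlace ι) γ ι P) :
    ∀ (W : WeierstrassCurve ℚ) [W.IsElliptic] [W.IsGloballyMinimal] (p : ℕ) [Fact p.Prime]
    [NeZero (W.conductorNorm ℤ)] (K : Type) [Field K] [NumberField K],
    Literature.NumberTheory.EllipticCurves.Rank1Residual.ClassX10 W p →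
    ¬ Literature.NumberTheory.EllipticCurves.Rank1Residual.Surj W 3 → ¬ W.HasCM →
    Literature.NumberTheory.EllipticCurves.IsImaginaryQuadratic K → Odd (NumberField.discr K) →
    NumberField.discr K ≠ -3 →
    Literature.NumberTheory.EllipticCurves.SatisfiesHeegnerHypothesis (W.conductorNorm ℤ) K →
    Literature.NumberTheory.EllipticCurves.SatisfiesHeegnerHypothesis p K →
    (W.baseChange K).HasIrreducibleModPGaloisRep p →
    ∀ (ι : K →+* ℚ_[p]) (κ : Literature.NumberTheory.EllipticCurves.ZpExtension K p), κ.IsAnticyclotomic →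
    ∀ (γ : Field.absoluteGaloisGroup K) [Fact (κ.IsTopGenerator γ)]
      (Dt : Literature.NumberTheory.EllipticCurves.ModularForms.ModularParametrizationData W
        (W.conductorNorm ℤ)), ¬ (p : ℤ) ∣ Dt.c →
    ∀ (H : Literature.NumberTheory.EllipticCurves.HeegnerDatum (W.conductorNorm ℤ) (NumberField.discr K))
      (ιC : K →+* ℂ) (P : (W.baseChange K).toAffine.Point),
      WeierstrassCurve.Affine.Point.map ιC.toRatAlgHom P =
        Literature.NumberTheory.EllipticCurves.ModularForms.heegnerPointComplex Dt H →
      (W.baseChange K).mordellWeilRank = 1 →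
      Finite (AddCommGroup.primaryComponent (W.baseChange K).sha p) → ¬ IsOfFinAddOrder P →
      Summit.BirchSwinnertonDyer.Rank1Residual.X11b.IMCWaldspurgerOnTreeGoodAt p κ
        (Summit.BirchSwinnertonDyer.Rank1Residual.X11b.inducedPlace ι) γ ι P := by
  intro W _ _ p _ _ K _ _ hX hns hcm hK hodd h3 hHN hHp hirrK ι κ hκ γ _ Dt hc H ιC P hP hrk hfin hPinf
  -- `d_K ≠ -4` is free on an odd discriminant
  have h4 : NumberField.discr K ≠ -4 := fun h ↦ by
    rw [h] at hodd
    exact (Int.not_odd_iff_even.mpr ⟨-2, by norm_num⟩) hodd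
  exact hB W p K hX hns hcm hK hodd h3 h4 hHN hHp hirrK ι κ hκ γ Dt hc H ιC P hP hrk hfin hPinf
    (hA W p K hX hns hcm hK hodd h3 h4 hHN hHp hirrK ι κ hκ γ Dt hc H ιC P hP hrk hfin hPinf)

/-- **The ONE-LINE re-run recipe for crux 23055 under ANY typing of the twins**: matched twins for an
arbitrary package `R` + the three named facts give `BeyondCarrierDepthX10b` BY NAME. Instances: the
rev-19 items (A₃ = 23729, B₃ = 23730; `R := ∃ jbar D F X, I(ℋ_F)² ≤ char(X_tors)`), x10b-p1-w2's sharp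
A₃♯ (p606574), and the plan g9 PIN-1 pinned items of PrintX10b rev 20 (`R := ∃ jbar D F X, F.Dt = Dt ∧
…`) — each by weakening its A to the sharp frame and feeding its B. Conditional; beyond-print theorem: no.
[cite: Cha2005, Thm. 21 and Rmk. 25] [cite: JetchevSkinnerWan2017, Thm. 3.3.1] [cite: Kolyvagin1990, Thm. A] -/
theorem beyondCarrierDepthX10b_of_matchedTwins_of_namedFacts
    (R : ∀ (W : WeierstrassCurve ℚ) [NeZero (W.conductorNorm ℤ)] (p : ℕ) [Fact p.Prime]
      (K : Type) [Field K] [NumberField K],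
      Literature.NumberTheory.EllipticCurves.ZpExtension K p → Field.absoluteGaloisGroup K →
      Literature.NumberTheory.EllipticCurves.ModularForms.ModularParametrizationData W (W.conductorNorm ℤ) →
      Literature.NumberTheory.EllipticCurves.HeegnerDatum (W.conductorNorm ℤ) (NumberField.discr K) →
      (K →+* ℂ) → Prop)
    (hA : ∀ (W : WeierstrassCurve ℚ) [W.IsElliptic] [W.IsGloballyMinimal] (p : ℕ) [Fact p.Prime]
    [NeZero (W.conductorNorm ℤ)] (K : Type) [Field K] [NumberField K],
    Literature.NumberTheory.EllipticCurves.Rank1Residual.ClassX10 W p →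
    ¬ Literature.NumberTheory.EllipticCurves.Rank1Residual.Surj W 3 → ¬ W.HasCM →
    Literature.NumberTheory.EllipticCurves.IsImaginaryQuadratic K → Odd (NumberField.discr K) →
    NumberField.discr K ≠ -3 → NumberField.discr K ≠ -4 →
    Literature.NumberTheory.EllipticCurves.SatisfiesHeegnerHypothesis (W.conductorNorm ℤ) K →
    Literature.NumberTheory.EllipticCurves.SatisfiesHeegnerHypothesis p K →
    (W.baseChange K).HasIrreducibleModPGaloisRep p →
    ∀ (ι : K →+* ℚ_[p]) (κ : Literature.NumberTheory.EllipticCurves.ZpExtension K p), κ.IsAnticyclotomic →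
    ∀ (γ : Field.absoluteGaloisGroup K) [Fact (κ.IsTopGenerator γ)]
      (Dt : Literature.NumberTheory.EllipticCurves.ModularForms.ModularParametrizationData W
        (W.conductorNorm ℤ)), ¬ (p : ℤ) ∣ Dt.c →
    ∀ (H : Literature.NumberTheory.EllipticCurves.HeegnerDatum (W.conductorNorm ℤ) (NumberField.discr K))
      (ιC : K →+* ℂ) (P : (W.baseChange K).toAffine.Point),
      WeierstrassCurve.Affine.Point.map ιC.toRatAlgHom P =
        Literature.NumberTheory.EllipticCurves.ModularForms.heegnerPointComplex Dt H →
      (W.baseChange K).mordellWeilRank = 1 →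
      Finite (AddCommGroup.primaryComponent (W.baseChange K).sha p) → ¬ IsOfFinAddOrder P →
      R W p K κ γ Dt H ιC)
    (hB : ∀ (W : WeierstrassCurve ℚ) [W.IsElliptic] [W.IsGloballyMinimal] (p : ℕ) [Fact p.Prime]
    [NeZero (W.conductorNorm ℤ)] (K : Type) [Field K] [NumberField K],
    Literature.NumberTheory.EllipticCurves.Rank1Residual.ClassX10 W p →
    ¬ Literature.NumberTheory.EllipticCurves.Rank1Residual.Surj W 3 → ¬ W.HasCM →
    Literature.NumberTheory.EllipticCurves.IsImaginaryQuadratic K → Odd (NumberField.discr K) →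
    NumberField.discr K ≠ -3 → NumberField.discr K ≠ -4 →
    Literature.NumberTheory.EllipticCurves.SatisfiesHeegnerHypothesis (W.conductorNorm ℤ) K →
    Literature.NumberTheory.EllipticCurves.SatisfiesHeegnerHypothesis p K →
    (W.baseChange K).HasIrreducibleModPGaloisRep p →
    ∀ (ι : K →+* ℚ_[p]) (κ : Literature.NumberTheory.EllipticCurves.ZpExtension K p), κ.IsAnticyclotomic →
    ∀ (γ : Field.absoluteGaloisGroup K) [Fact (κ.IsTopGenerator γ)]
      (Dt : Literature.NumberTheory.EllipticCurves.ModularForms.ModularParametrizationData W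
        (W.conductorNorm ℤ)), ¬ (p : ℤ) ∣ Dt.c →
    ∀ (H : Literature.NumberTheory.EllipticCurves.HeegnerDatum (W.conductorNorm ℤ) (NumberField.discr K))
      (ιC : K →+* ℂ) (P : (W.baseChange K).toAffine.Point),
      WeierstrassCurve.Affine.Point.map ιC.toRatAlgHom P =
        Literature.NumberTheory.EllipticCurves.ModularForms.heegnerPointComplex Dt H →
      (W.baseChange K).mordellWeilRank = 1 →
      Finite (AddCommGroup.primaryComponent (W.baseChange K).sha p) → ¬ IsOfFinAddOrder P →
      R W p K κ γ Dt H ιC →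
      Summit.BirchSwinnertonDyer.Rank1Residual.X11b.IMCWaldspurgerOnTreeGoodAt p κ
        (Summit.BirchSwinnertonDyer.Rank1Residual.X11b.inducedPlace ι) γ ι P)
    (h331 : thm331_anticyclotomicControl)
    (hChaL : Cha2005.rmk25_pow_dvd_card_sha_primary_of_certificate)
    (hKo : ∀ (N : ℕ) [NeZero N] (W : WeierstrassCurve ℚ) (K : Type) [Field K] [NumberField K],
      kolyvagin N W K) :
    BeyondCarrierDepthX10b :=
  beyondCarrierDepthX10b_of_waldspurgerLink_of_namedFacts h331 hChaL hKo
    (waldspurgerLink_of_matchedTwins R hA hB)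

end Summit.BirchSwinnertonDyer.BirchSwinnertonDyer.Cruxes.BeyondCarrierDepthX10b.HowardFrames

end
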